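/-
Copyright: lit-balaban Phase-2 proof seat p08 (gen 7).  Statement-level skeleton of a published paper; no proof claims beyond what
the kernel checks below.
-/
import Literature.MathematicalPhysics.QuantumFieldTheory.BalabanImbrieJaffe1984to88.BIJ85Eq625Torus
import Literature.MathematicalPhysics.QuantumFieldTheory.BalabanImbrieJaffe1984to88.BIJ88Eq220Proof
import Literature.MathematicalPhysics.QuantumFieldTheory.BalabanImbrieJaffe1984to88.BIJ88Eq215Proof

/-!
# `BalabanImbrieJaffe1984to88.BIJ88Eq220Torus` — T. Bałaban, J. Imbrie, A. Jaffe, *Effective action and cluster properties of the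
abelian Higgs model*, Commun. Math. Phys. **114** (1988) 257–315 [BalabanImbrieJaffe1988]: **(2.20)–(2.22)** p. 262, the kernel
generating the gauge transformation, `(Q^{s*}_k − 𝒟_k∂*Q^{e*}_k∂)A = H_kA + ∂C_kA` (2.20) with `H_{k,Ax}B = H_kB + ∂D_kB` (2.21) and
`C_k = D_k + Σ_{j=0}^{k−1} D_jC^{(j)}H_j^*∂*Q^{e*}_k∂` (2.22) — PROVED OUTRIGHT AT THE TORUS MODEL OF RECORD: the operators are
seat p11's / p30's linear maps between the Euclidean carriers of [I] Sects. 4–5 on the tori of `Balaban1983to89.Setup`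
(`QsE`, `DkE`, `QesOp`, `dOne`, `HaxE`, `HkE`, `CE`, `lamE`, `D527E`, `curlOp`, `gradV1`), the gauge transformations `D_j` and the
kernel `C_k` are DEFINED here by the printed formulas ((2.21): `D_jB = λ_j(H_jB)`, [I] Prop. 5.1.1; (2.22) verbatim), and the four
[I]-inputs of the knitting `BIJ88Eq220Proof.eq220` (p02 g2) — (I.5.3.1), (I.5.1.1), (I.5.2.6), (I.5.2.7) — are torus THEOREMS
(`BIJ85Eq625Torus.HaxE_eq_531`, `BIJ85Prop522Torus.HaxE_sub_HkE`, `BIJ85Prop522Torus.prop522_torus`, the definition of `D527E`), so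
(2.20) holds on the tori with NO hypothesis of printed shape

statement-level skeleton of published theorems with citation tags; proofs where landed; nothing here is a claim about the Yang–Mills mass gap

PDF held: `paper:balaban1988-cmp114-bij-abelian-higgs-effective-action` (journal page = PDF page + 256), p. 262 [PDF 6] (text layer
`~/.lit/texts/paper-balaban1988-cmp114-bij-abelian-higgs-effective-action/p0006.txt`, re-read this session); (I) =
[BalabanImbrieJaffe1985] (`paper:balaban1985-cmp97-bij-higgs-minimizers`): Prop. 5.1.1 (5.1.1) p. 313–314, Prop. 5.2.2
(5.2.6)–(5.2.7) p. 316, (5.3.1) p. 317, (4.4.4) p. 312.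

CITATION HEADER (lean-in-tree rule).  Part of the lit-balaban TYPED SKELETON (HOME `run/shared/lean/pub/lit-balaban/`), Phase-2 proof
seat p08 (gen 7), unit `lit-balaban-p08`; WHAT IS REPRODUCED = SKELETON rows **C2.Eq2.20** (IDENTITY; reader file
`HOME/lit-balaban-r18/ROWS-C2.md`, owner r18, referee ref-5: *"proved p247500 (p02 g2; knitting identity, C1 inputs displayed)"*),
**C2.Eq2.22** (DEF `C_k`; *"typed p239939 · used in the proof of (2.20) p247500"*) and the Euclidean-carrier form of **C2.Eq2.21**
(torus instance of record on r15's `GaugeRG` carrier: p02 g4 `BIJ88Eq221Torus.eq221_torus`), kind «model instance».  TAKING line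
HOME/STATUS.md 2026-08-21T07:46:43Z.

THE PRINTED TEXT (p. 262 [PDF 6], verbatim): *"Another important kernel is the one generating the gauge transformation:
(Q^{s*}_k − 𝒟_k∂*Q^{e*}_k∂)A = H_kA + ∂C_kA. (2.20) The kernel C_k is constructed from the basic gauge transformation D_k which changes
the minimizer from axial to Landau gauge (I.5.1.1): H_{k,Ax}B = H_kB + ∂D_kB. (2.21) By changing gauge in each term in the hierarchical
sum defining 𝒟_k and applying (I.5.3.1), we obtain C_k = D_k + Σ_{j=0}^{k−1} D^{L^jη}_jC^{(j),L^jη}H^{*L^jη}_j∂*Q^{e*}_k∂. (2.22)"*.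
The inputs, verbatim: (I) p. 317 *"H_{k,Ax}B = Q^{s*}_kB − G_{k,Ax}∂*Q^{e*}_k∂B. (5.3.1)"*; (I) p. 313 *"H_{k,Ax}B − H_kB = ∂λ. (5.1.1)
We show that λ is an explicit, linear function of H_kB"*; (I) p. 316 *"Proposition 5.2.2. There is a gauge transformation D such that
G_{k,Ax}∂* − 𝒟_k∂* = ∂D. (5.2.6) Explicitly D = Σ_{j=0}^{k−1} λ_j(H_jC^{(j)}H*_j∂*), (5.2.7) where λ_j is the function of Proposition
5.1.1 with k set equal to j"*; (I) p. 312 *"𝒟_k ≡ Σ_{j=0}^{k−1} H_jC^{(j)}H*_j. (4.4.4)"*.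

THE TORUS DATA (all in the tree; standing range `k ≤ m + K` of `Setup`, weight `w = η^d > 0`, lattice factor `c = η⁻¹ ≠ 0`,
`2 ≤ d`): unit-lattice bond fields `A, B : CoarseSpace P k` (on `T^{(k)}`; `CoarseSpace P j` on `T^{(j)}`), η-bond fields `BondSpace P`,
η-plaquette fields `PlaqSpace P`, unit-lattice plaquette fields `UnitPlaqSpace P k`, gauge functions `EuclideanSpace ℝ (Site P 0)`;
`Q^{s*}_k = QsE P k` (p30), `𝒟_k = DkE P w c k` ((4.4.4) verbatim, p11), `∂* = LinearMap.adjoint (curlOp w c)` (p09's weighted curl),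
`Q^{e*}_k = QesOp hd w k` (p30), `∂` on unit bond fields = `dOne P k c` (p30), `H_{k,Ax} = HaxE P w c k`, `H_j = HkE P w c j` (Landau,
(4.4.2)), `C^{(j)} = CE P w c j` ((4.3.3)), `H_j^* = LinearMap.adjoint (HkE P w c j)`, `λ_j = lamE P c j` ((5.1.13)), `∂` on gauge
functions = `gradV1 P c`, `D = D527E P w c k` ((5.2.7) verbatim), `G_{k,Ax} = GaxE P w c k` ((5.2.2) = (4.1.1)).

WHAT IS PROVED (0 `sorry`, standard axioms):
* §1 **(2.21)**: `DjE P w c j := λ_j ∘ H_j` — *"the basic gauge transformation D_j which changes the minimizer from axial to Landau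
  gauge"* ((I) Prop. 5.1.1: `λ = λ_j(H_jB)`); `eq221_torusE`: `H_{j,Ax}B = H_jB + ∂D_jB` for EVERY `B : CoarseSpace P j`, `j ≤ m + K`
  (p11's `HaxE_sub_HkE`), operator form `eq221_torusE_op`.
* §2 **(2.22)**: `CkE P hd w c k := D_k + Σ_{j<k} D_j ∘ C^{(j)} ∘ H_j^* ∘ ∂* ∘ Q^{e*}_k ∘ ∂` — VERBATIM; `CkE_eq_D527E`: the hierarchical
  sum IS (I.5.2.7)'s `D` composed with `Q^{e*}_k∂` (*"by changing gauge in each term in the hierarchical sum defining 𝒟_k"*):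
  `C_k = D_k + DQ^{e*}_k∂`.
* §3 **(2.20) ON THE TORI**, `eq220_torus_apply` / **`eq220_torus`**: `(Q^{s*}_k − 𝒟_k∂*Q^{e*}_k∂)A = H_kA + ∂C_kA` for every `A`, resp.
  as an identity of linear maps `CoarseSpace P k → BondSpace P`, with `C_k = CkE` and NO hypothesis of printed shape: the printed
  derivation — (I.5.3.1) `HaxE_eq_531`, then (I.5.2.6) `prop522_torus_apply` on the source `Q^{e*}_k∂A`, then (2.21) — carried out on
  the tori; `eq220_torus_unique` ((2.20) determines `∂C_k`).
* §4 r18's typed ring statements **`BIJ88Sect2Statements.Eq221` / `Eq220` with `C_k = BIJ88Sect2Statements.cK`** INHABITED at the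
  torus operators placed in one ring `Module.End ℝ V` by p02's split-embedding dictionary (`BIJ88Eq215Proof.Slot`/`emb`), the single
  ring element `d` being the TOTAL DIFFERENTIAL `emb(∂ : unit bonds → unit plaquettes) + emb(∂ : gauge functions → η-bonds)` of p02's
  honest-scope reading (*"sound for operators extended by zero on the graded space Ω⁰ ⊕ Ω¹ ⊕ Ω² with d the total differential"*) —
  made precise: it suffices that the slots of the unit plaquette fields / η-bond fields and of the level-`k` unit bond fields / gauge
  functions are ORTHOGONAL (`π ∘ ι = 0`, `eq220_typed_torus`; `eq221_typed_torus` needs nothing), which holds on the canonical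
  product carrier `Carrier P k = (Π j, CoarseSpace P j) × (BondSpace P × (PlaqSpace P × (UnitPlaqSpace P k × gauge functions)))`
  (`slotOne_orth_slotA`, `slotB_orth_slotG`) — **`eq220_typed_torus_prod`**: `Eq220 … (cK …)` with no hypothesis and no choice left.
HONEST SCOPE.  One torus at a time (`P`, `k ≤ m + K`); all operators on the SAME fine η-lattice (the superscripts `L^jη` of (2.22)
are the instance's: the `j`-th term acts through `T^{(j)}`-fields `CoarseSpace P j`, as in p11's (4.4.4)/(5.2.7)); nothing on the decay
(2.23)–(2.26) or on `∂C_k`; NOT summit progress.  New definitions: the operators `DjE` ((2.21)), `CkE` ((2.22)); plumbing for §4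
`piSlot`, `Tail`, `Carrier`, `slotB`, `slotA`, `slotT`, `slotEta`, `slotOne`, `slotG` (the canonical carrier and its slots) — no
`def … : Prop`, no named fact (D-0026).  Unit `lit-balaban-p08` (literature-prover-lit-balaban-p08-g7-0), 2026-08-21.
-/

open scoped BigOperators

namespace Literature.MathematicalPhysics.QuantumFieldTheory.BalabanImbrieJaffe1984to88.BIJ88Eq220Torus

open Literature.MathematicalPhysics.QuantumFieldTheory.Balaban1983to89
open BIJ85AxialPropagator411 BIJ85Prop521Torus BIJ85Sigma421Torus BIJ85LandauMinimizer442V1 BIJ85Prop511Torus BIJ85Eq611Torus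
  BIJ85Prop522Torus BIJ85Eq625Torus

noncomputable section

variable {P : Params}

/-! ## §1  (2.21): the basic gauge transformation `D_j` on the tori -/

variable (P) in
/-- **`D_j` of (2.21)** — *"the basic gauge transformation D_k which changes the minimizer from axial to Landau gauge (I.5.1.1)"*: by
(I) Proposition 5.1.1 (*"λ is an explicit, linear function of H_kB"*, λ = λ_k of (5.1.13)) `D_jB = λ_j(H_jB)`, i.e. `D_j = λ_j ∘ H_j`
as a linear map `T^{(j)}`-bond fields → gauge functions (`lamE`, p30; `HkE`, p11). [cite: BalabanImbrieJaffe1988, (2.21) p.262] -/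
def DjE (w c : ℝ) (j : ℕ) : CoarseSpace P j →ₗ[ℝ] EuclideanSpace ℝ (Site P 0) :=
  lamE P c j ∘ₗ HkE P w c j

/-- unfolding `D_j`: `D_jB = λ_j(H_jB)`. [cite: BalabanImbrieJaffe1988, (2.21) p.262] -/
theorem DjE_apply (w c : ℝ) (j : ℕ) (B : CoarseSpace P j) : DjE P w c j B = lamE P c j (HkE P w c j B) := rfl

/-- **(2.21) ON THE TORI** p. 262, verbatim: *"H_{k,Ax}B = H_kB + ∂D_kB. (2.21)"* — for EVERY unit-lattice bond field `B` on `T^{(j)}`,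
`j ≤ m + K`, `c ≠ 0`, `w > 0`, with `H_{j,Ax} = HaxE`, `H_j = HkE` (Landau), `∂ = gradV1 P c`, `D_j = DjE`: (I) Proposition 5.1.1 on
the tori (p11's `BIJ85Prop522Torus.HaxE_sub_HkE`). [cite: BalabanImbrieJaffe1988, (2.21) p.262] -/
theorem eq221_torusE {j : ℕ} (hj : j ≤ P.m + P.K) {c : ℝ} (hc : c ≠ 0) {w : ℝ} (hw : 0 < w) (B : CoarseSpace P j) :
    HaxE P w c j B = HkE P w c j B + gradV1 P c (DjE P w c j B) := by
  rw [DjE_apply, ← HaxE_sub_HkE hj hc hw B, add_sub_cancel]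

/-- (2.21) on the tori as an identity of linear maps: `H_{j,Ax} = H_j + ∂ ∘ D_j`. [cite: BalabanImbrieJaffe1988, (2.21) p.262] -/
theorem eq221_torusE_op {j : ℕ} (hj : j ≤ P.m + P.K) {c : ℝ} (hc : c ≠ 0) {w : ℝ} (hw : 0 < w) :
    HaxE P w c j = HkE P w c j + gradV1 P c ∘ₗ DjE P w c j := by
  apply LinearMap.ext
  intro B
  rw [LinearMap.add_apply, LinearMap.comp_apply]
  exact eq221_torusE hj hc hw B

/-! ## §2  (2.22): the kernel `C_k` on the tori -/

variable (P) in
/-- **`C_k` of (2.22)** p. 262, verbatim: *"C_k = D_k + Σ_{j=0}^{k−1} D^{L^jη}_jC^{(j),L^jη}H^{*L^jη}_j∂*Q^{e*}_k∂. (2.22)"* — as a linear map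
unit-lattice bond fields on `T^{(k)}` → gauge functions: `D_k + Σ_{j<k} D_j ∘ C^{(j)} ∘ H_j^* ∘ ∂* ∘ Q^{e*}_k ∘ ∂` with `D_j = DjE`,
`C^{(j)} = CE`, `H_j^* = adjoint HkE`, `∂* = adjoint (curlOp w c)`, `Q^{e*}_k = QesOp hd w k`, `∂ = dOne P k c`.
[cite: BalabanImbrieJaffe1988, (2.22) p.262] -/
def CkE (hd : 2 ≤ P.d) (w c : ℝ) (k : ℕ) : CoarseSpace P k →ₗ[ℝ] EuclideanSpace ℝ (Site P 0) :=
  DjE P w c k + ∑ j ∈ Finset.range k, DjE P w c j ∘ₗ CE P w c j ∘ₗ LinearMap.adjoint (HkE P w c j) ∘ₗ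
    LinearMap.adjoint (curlOp (P := P) w c) ∘ₗ QesOp (P := P) hd w k ∘ₗ dOne P k c

/-- unfolding `C_k` at a configuration: `C_kA = D_kA + Σ_{j<k} D_j(C^{(j)}(H_j^*(∂*(Q^{e*}_k(∂A)))))`. [cite: BalabanImbrieJaffe1988, (2.22) p.262] -/
theorem CkE_apply (hd : 2 ≤ P.d) (w c : ℝ) (k : ℕ) (A : CoarseSpace P k) :
    CkE P hd w c k A = DjE P w c k A + ∑ j ∈ Finset.range k, DjE P w c j (CE P w c j (LinearMap.adjoint (HkE P w c j)
      (LinearMap.adjoint (curlOp (P := P) w c) (QesOp (P := P) hd w k (dOne P k c A))))) := by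
  simp only [CkE, LinearMap.add_apply, LinearMap.sum_apply, LinearMap.coe_comp, Function.comp_apply]

/-- *"By changing gauge in each term in the hierarchical sum defining 𝒟_k"*: the sum in (2.22) IS the gauge transformation `D` of
(I.5.2.7) (`D = Σ_{j<k} λ_j(H_jC^{(j)}H_j^*∂*)`, p11's `D527E`) composed with the source map `Q^{e*}_k∂` — `C_k = D_k + D ∘ Q^{e*}_k ∘ ∂`.
[cite: BalabanImbrieJaffe1988, (2.22) p.262] -/
theorem CkE_eq_D527E (hd : 2 ≤ P.d) (w c : ℝ) (k : ℕ) :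
    CkE P hd w c k = DjE P w c k + D527E P w c k ∘ₗ QesOp (P := P) hd w k ∘ₗ dOne P k c := by
  apply LinearMap.ext
  intro A
  rw [CkE_apply, LinearMap.add_apply, LinearMap.comp_apply, LinearMap.comp_apply, D527E_apply]
  simp only [DjE_apply]

/-! ## §3  (2.20) on the tori -/

/-- **(2.20) ON THE TORI, configuration form** p. 262 [PDF 6], verbatim: *"(Q^{s*}_k − 𝒟_k∂*Q^{e*}_k∂)A = H_kA + ∂C_kA. (2.20)"* — for
EVERY unit-lattice bond field `A` on `T^{(k)}` (`k ≤ m + K`, `c ≠ 0`, `w > 0`, `2 ≤ d`), with `C_k = CkE` of (2.22) and the Landau `H_k`;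
the printed derivation on the tori: (I.5.3.1) `Q^{s*}_kA = H_{k,Ax}A + G_{k,Ax}∂*Q^{e*}_k∂A` (`HaxE_eq_531`), (I.5.2.6) on the source
`J = Q^{e*}_k∂A`: `G_{k,Ax}∂*J − 𝒟_k∂*J = ∂(DJ)` (`eq526_torus`), and (2.21) `H_{k,Ax}A = H_kA + ∂D_kA` (`eq221_torusE`).
[cite: BalabanImbrieJaffe1988, (2.20) p.262] -/
theorem eq220_torus_apply (hd : 2 ≤ P.d) {k : ℕ} (hk : k ≤ P.m + P.K) {c : ℝ} (hc : c ≠ 0) {w : ℝ} (hw : 0 < w)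
    (A : CoarseSpace P k) :
    QsE P k A - DkE P w c k (LinearMap.adjoint (curlOp (P := P) w c) (QesOp (P := P) hd w k (dOne P k c A))) =
      HkE P w c k A + gradV1 P c (CkE P hd w c k A) := by
  have h531 := LinearMap.congr_fun (HaxE_eq_531 hd hk hc hw) A
  simp only [LinearMap.sub_apply, LinearMap.coe_comp, Function.comp_apply] at h531
  have hQ : QsE P k A = HaxE P w c k A +
      GaxE P w c k (LinearMap.adjoint (curlOp (P := P) w c) (QesOp (P := P) hd w k (dOne P k c A))) := by
    rw [h531, sub_add_cancel]
  have h526 := eq526_torus hk hc hw (QesOp (P := P) hd w k (dOne P k c A))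
  rw [CkE_eq_D527E, LinearMap.add_apply, LinearMap.comp_apply, LinearMap.comp_apply, map_add, ← h526, hQ,
    eq221_torusE hk hc hw A]
  abel

/-- **(2.20) ON THE TORI as an identity of linear maps** `CoarseSpace P k → BondSpace P`:
`Q^{s*}_k − 𝒟_k ∘ ∂* ∘ Q^{e*}_k ∘ ∂ = H_k + ∂ ∘ C_k`, `C_k = CkE` of (2.22); `k ≤ m + K`, `c ≠ 0`, `w > 0`, `2 ≤ d`.
[cite: BalabanImbrieJaffe1988, (2.20) p.262] -/
theorem eq220_torus (hd : 2 ≤ P.d) {k : ℕ} (hk : k ≤ P.m + P.K) {c : ℝ} (hc : c ≠ 0) {w : ℝ} (hw : 0 < w) :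
    QsE P k - DkE P w c k ∘ₗ LinearMap.adjoint (curlOp (P := P) w c) ∘ₗ QesOp (P := P) hd w k ∘ₗ dOne P k c =
      HkE P w c k + gradV1 P c ∘ₗ CkE P hd w c k := by
  apply LinearMap.ext
  intro A
  simp only [LinearMap.sub_apply, LinearMap.add_apply, LinearMap.coe_comp, Function.comp_apply]
  exact eq220_torus_apply hd hk hc hw A

/-- (2.20) with (2.22) substituted and the hierarchical sum read through (I.5.2.7): `Q^{s*}_k − 𝒟_k∂*Q^{e*}_k∂ = H_k + ∂(D_k + DQ^{e*}_k∂)`.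
[cite: BalabanImbrieJaffe1988, (2.20)–(2.22) p.262] -/
theorem eq220_torus_D527E (hd : 2 ≤ P.d) {k : ℕ} (hk : k ≤ P.m + P.K) {c : ℝ} (hc : c ≠ 0) {w : ℝ} (hw : 0 < w) :
    QsE P k - DkE P w c k ∘ₗ LinearMap.adjoint (curlOp (P := P) w c) ∘ₗ QesOp (P := P) hd w k ∘ₗ dOne P k c =
      HkE P w c k + gradV1 P c ∘ₗ (DjE P w c k + D527E P w c k ∘ₗ QesOp (P := P) hd w k ∘ₗ dOne P k c) := by
  rw [← CkE_eq_D527E, eq220_torus hd hk hc hw]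

/-- (2.20) DETERMINES the gauge part: any kernel `C′` with `Q^{s*}_k − 𝒟_k∂*Q^{e*}_k∂ = H_k + ∂C′` on the torus has `∂C′ = ∂C_k`
(p02's ring-level `BIJ88Eq220Proof.eq220_unique`, here for the torus operators). [cite: BalabanImbrieJaffe1988, (2.20) p.262] -/
theorem eq220_torus_unique (hd : 2 ≤ P.d) {k : ℕ} (hk : k ≤ P.m + P.K) {c : ℝ} (hc : c ≠ 0) {w : ℝ} (hw : 0 < w)
    (C' : CoarseSpace P k →ₗ[ℝ] EuclideanSpace ℝ (Site P 0))
    (h : QsE P k - DkE P w c k ∘ₗ LinearMap.adjoint (curlOp (P := P) w c) ∘ₗ QesOp (P := P) hd w k ∘ₗ dOne P k c =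
      HkE P w c k + gradV1 P c ∘ₗ C') :
    gradV1 P c ∘ₗ C' = gradV1 P c ∘ₗ CkE P hd w c k :=
  add_left_cancel (h.symm.trans (eq220_torus hd hk hc hw))

/-! ## §4  r18's typed `Eq221` / `Eq220` with `cK` inhabited at the torus operators (p02's one-ring dictionary) -/

section Typed

open BIJ88Eq215Proof

variable {V : Type} [AddCommGroup V] [Module ℝ V]

/-- plumbing: embedded SUMS are sums of embedded operators (`emb` is additive). [cite: BalabanImbrieJaffe1988, (2.22) p.262] -/
theorem emb_add {X Y : Type} [AddCommGroup X] [Module ℝ X] [AddCommGroup Y] [Module ℝ Y] (sY : Slot (𝕜 := ℝ) Y V)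
    (sX : Slot (𝕜 := ℝ) X V) (f g : X →ₗ[ℝ] Y) : emb sY sX (f + g) = emb sY sX f + emb sY sX g := by
  unfold BIJ88Eq215Proof.emb
  rw [LinearMap.add_comp, LinearMap.comp_add]

/-- plumbing: `emb` of a finite sum. [cite: BalabanImbrieJaffe1988, (2.22) p.262] -/
theorem emb_sum {X Y : Type} [AddCommGroup X] [Module ℝ X] [AddCommGroup Y] [Module ℝ Y] (sY : Slot (𝕜 := ℝ) Y V)
    (sX : Slot (𝕜 := ℝ) X V) (s : Finset ℕ) (f : ℕ → (X →ₗ[ℝ] Y)) :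
    emb sY sX (∑ j ∈ s, f j) = ∑ j ∈ s, emb sY sX (f j) := by
  classical
  induction s using Finset.induction_on with
  | empty =>
    rw [Finset.sum_empty, Finset.sum_empty]
    unfold BIJ88Eq215Proof.emb
    rw [LinearMap.zero_comp, LinearMap.comp_zero]
  | @insert j s hj ih => rw [Finset.sum_insert hj, Finset.sum_insert hj, emb_add, ih]

/-- plumbing: a product of embedded operators through ORTHOGONAL slots (`π_Y ∘ ι_{Y′} = 0`) vanishes — the cross terms of the total
differential. [cite: BalabanImbrieJaffe1988, (2.20) p.262] -/
theorem emb_mul_orth {X Y Y' Z : Type} [AddCommGroup X] [Module ℝ X] [AddCommGroup Y] [Module ℝ Y] [AddCommGroup Y'] [Module ℝ Y']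
    [AddCommGroup Z] [Module ℝ Z] (sZ : Slot (𝕜 := ℝ) Z V) (sY : Slot (𝕜 := ℝ) Y V) (sY' : Slot (𝕜 := ℝ) Y' V)
    (sX : Slot (𝕜 := ℝ) X V) (g : Y →ₗ[ℝ] Z) (f : X →ₗ[ℝ] Y') (horth : sY.π ∘ₗ sY'.ι = 0) :
    emb sZ sY g * emb sY' sX f = 0 := by
  unfold BIJ88Eq215Proof.emb
  rw [Module.End.mul_eq_comp]
  simp only [LinearMap.comp_assoc]
  rw [← LinearMap.comp_assoc (f ∘ₗ sX.π) sY'.ι sY.π, horth, LinearMap.zero_comp, LinearMap.comp_zero, LinearMap.comp_zero]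

variable (sB : ∀ j : ℕ, Slot (𝕜 := ℝ) (CoarseSpace P j) V) (sA : Slot (𝕜 := ℝ) (BondSpace P) V)
  (sη : Slot (𝕜 := ℝ) (PlaqSpace P) V) (sG : Slot (𝕜 := ℝ) (EuclideanSpace ℝ (Site P 0)) V)

/-- **r18's typed `BIJ88Sect2Statements.Eq221` HOLDS for the torus operators** embedded in one ring `Module.End ℝ V` (ANY slots):
`Eq221 H_{j,Ax} H_j ∂ D_j` with `H_{j,Ax} = HaxE`, `H_j = HkE`, `∂ = gradV1`, `D_j = DjE`; `j ≤ m + K`, `c ≠ 0`, `w > 0`.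
[cite: BalabanImbrieJaffe1988, (2.21) p.262] -/
theorem eq221_typed_torus {j : ℕ} (hj : j ≤ P.m + P.K) {c : ℝ} (hc : c ≠ 0) {w : ℝ} (hw : 0 < w) :
    BIJ88Sect2Statements.Eq221 (emb sA (sB j) (HaxE P w c j)) (emb sA (sB j) (HkE P w c j)) (emb sA sG (gradV1 P c))
      (emb sG (sB j) (DjE P w c j)) := by
  unfold BIJ88Sect2Statements.Eq221
  rw [emb_mul, ← emb_add, ← eq221_torusE_op hj hc hw]

variable {k : ℕ} (s₁ : Slot (𝕜 := ℝ) (UnitPlaqSpace P k) V)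

/-- **r18's typed `BIJ88Sect2Statements.Eq220` with `C_k` = the typed (2.22) `BIJ88Sect2Statements.cK` HOLDS for the torus operators**
embedded in one ring `Module.End ℝ V`: `Eq220 Q^{s*}_k 𝒟_k ∂* Q^{e*}_k d H_k (cK D_k D_• C^{(•)} H_•^* (∂*Q^{e*}_kd) k)` with
`Q^{s*}_k = QsE`, `𝒟_k = DkE`, `∂* = (curlOp)^*`, `Q^{e*}_k = QesOp`, `H_k = HkE`, `D_j = DjE`, `C^{(j)} = CE`, `H_j^* = (HkE)^*`, and the
single ring element `d` = THE TOTAL DIFFERENTIAL `emb(dOne : unit bonds → unit plaquettes) + emb(gradV1 : gauge functions → η-bonds)`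
(p02's graded reading of the typing of record), provided the slots of `UnitPlaqSpace`/`BondSpace` and of `CoarseSpace P k`/gauge
functions are orthogonal; `k ≤ m + K`, `c ≠ 0`, `w > 0`, `2 ≤ d`. [cite: BalabanImbrieJaffe1988, (2.20)–(2.22) p.262] -/
theorem eq220_typed_torus (hd : 2 ≤ P.d) (hk : k ≤ P.m + P.K) {c : ℝ} (hc : c ≠ 0) {w : ℝ} (hw : 0 < w)
    (h1A : s₁.π ∘ₗ sA.ι = 0) (hBG : (sB k).π ∘ₗ sG.ι = 0) :
    BIJ88Sect2Statements.Eq220 (emb sA (sB k) (QsE P k)) (emb sA sA (DkE P w c k))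
      (emb sA sη (LinearMap.adjoint (curlOp (P := P) w c))) (emb sη s₁ (QesOp (P := P) hd w k))
      (emb s₁ (sB k) (dOne P k c) + emb sA sG (gradV1 P c)) (emb sA (sB k) (HkE P w c k))
      (BIJ88Sect2Statements.cK (emb sG (sB k) (DjE P w c k)) (fun j => emb sG (sB j) (DjE P w c j))
        (fun j => emb (sB j) (sB j) (CE P w c j)) (fun j => emb (sB j) sA (LinearMap.adjoint (HkE P w c j)))
        (emb sA sη (LinearMap.adjoint (curlOp (P := P) w c)) * emb sη s₁ (QesOp (P := P) hd w k) *
          (emb s₁ (sB k) (dOne P k c) + emb sA sG (gradV1 P c))) k) := by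
  simp only [BIJ88Sect2Statements.Eq220, BIJ88Sect2Statements.cK, BIJ85Sect4Statements.curlyD]
  -- the source map `X = ∂*Q^{e*}_kd`: the gauge-function piece of `d` does not feed `Q^{e*}_k`
  have hX : emb sA sη (LinearMap.adjoint (curlOp (P := P) w c)) * emb sη s₁ (QesOp (P := P) hd w k) *
      (emb s₁ (sB k) (dOne P k c) + emb sA sG (gradV1 P c)) =
      emb sA (sB k) (LinearMap.adjoint (curlOp (P := P) w c) ∘ₗ QesOp (P := P) hd w k ∘ₗ dOne P k c) := by
    rw [emb_mul, mul_add, emb_mul, emb_mul_orth _ _ _ _ _ _ h1A, add_zero]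
    simp only [LinearMap.comp_assoc]
  -- left side: `Q^{s*}_k − 𝒟_k∂*Q^{e*}_kd` embedded
  have hL : emb sA (sB k) (QsE P k) - emb sA sA (DkE P w c k) * emb sA sη (LinearMap.adjoint (curlOp (P := P) w c)) *
      emb sη s₁ (QesOp (P := P) hd w k) * (emb s₁ (sB k) (dOne P k c) + emb sA sG (gradV1 P c)) =
      emb sA (sB k) (QsE P k - DkE P w c k ∘ₗ LinearMap.adjoint (curlOp (P := P) w c) ∘ₗ QesOp (P := P) hd w k ∘ₗ dOne P k c) := by
    rw [mul_assoc (emb sA sA (DkE P w c k)), mul_assoc (emb sA sA (DkE P w c k)), hX, emb_mul, emb_sub]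
  -- the hierarchical sum embedded
  have hS : ∑ j ∈ Finset.range k, emb sG (sB j) (DjE P w c j) * emb (sB j) (sB j) (CE P w c j) *
      (emb (sB j) sA (LinearMap.adjoint (HkE P w c j)) *
        emb sA (sB k) (LinearMap.adjoint (curlOp (P := P) w c) ∘ₗ QesOp (P := P) hd w k ∘ₗ dOne P k c)) =
      emb sG (sB k) (∑ j ∈ Finset.range k, DjE P w c j ∘ₗ CE P w c j ∘ₗ LinearMap.adjoint (HkE P w c j) ∘ₗ
        LinearMap.adjoint (curlOp (P := P) w c) ∘ₗ QesOp (P := P) hd w k ∘ₗ dOne P k c) := by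
    rw [emb_sum]
    refine Finset.sum_congr rfl fun j _ => ?_
    rw [emb_mul, emb_mul, emb_mul]
    simp only [LinearMap.comp_assoc]
  -- right side: `d·C_k` embedded; the unit-plaquette piece of `d` does not see gauge functions
  rw [hX, hL, hS, ← emb_add, add_mul, emb_mul_orth _ _ _ _ _ _ hBG, zero_add, emb_mul, ← emb_add]
  congr 1
  simpa only [CkE] using eq220_torus hd hk hc hw

end Typed

/-! ### The canonical carrier: all `T^{(j)}`-bond fields at once, η-bonds, η-plaquettes, unit plaquettes, gauge functions -/

section Canonical

open BIJ88Eq215Proof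

variable (P) in
/-- plumbing: the `j`-th factor of the product `Π i, CoarseSpace P i` (all `T^{(i)}`-bond fields at once) is a slot
(`LinearMap.single` / `LinearMap.proj`). [cite: BalabanImbrieJaffe1988, (2.22) p.262] -/
def piSlot (j : ℕ) : Slot (𝕜 := ℝ) (CoarseSpace P j) (Π i : ℕ, CoarseSpace P i) where
  ι := LinearMap.single ℝ (fun i => CoarseSpace P i) j
  π := LinearMap.proj j
  πι := LinearMap.proj_comp_single_same ℝ (fun i => CoarseSpace P i) j

variable (P) in
/-- plumbing: the graded tail `Ω¹_η ⊕ Ω²_η ⊕ Ω²_1 ⊕ Ω⁰_η` of the canonical carrier — η-bond fields, η-plaquette fields, unit-lattice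
plaquette fields on `T^{(k)}`, gauge functions. [cite: BalabanImbrieJaffe1988, (2.20) p.262] -/
abbrev Tail (k : ℕ) : Type := BondSpace P × (PlaqSpace P × (UnitPlaqSpace P k × EuclideanSpace ℝ (Site P 0)))

variable (P) in
/-- plumbing: the canonical common carrier `(Π j, CoarseSpace P j) × Tail P k` on which every operator of (2.20)–(2.22) acts
(extended by zero). [cite: BalabanImbrieJaffe1988, (2.20) p.262] -/
abbrev Carrier (k : ℕ) : Type := (Π i : ℕ, CoarseSpace P i) × Tail P k

variable (P) in
/-- plumbing: the slot of the `T^{(j)}`-bond fields in the canonical carrier. [cite: BalabanImbrieJaffe1988, (2.22) p.262] -/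
def slotB (k j : ℕ) : Slot (𝕜 := ℝ) (CoarseSpace P j) (Carrier P k) :=
  (Slot.inl (𝕜 := ℝ) (Π i : ℕ, CoarseSpace P i) (Tail P k)).comp (piSlot P j)

variable (P) in
/-- plumbing: the slot of the η-bond fields in the canonical carrier. [cite: BalabanImbrieJaffe1988, (2.20) p.262] -/
def slotA (k : ℕ) : Slot (𝕜 := ℝ) (BondSpace P) (Carrier P k) :=
  (Slot.inr (𝕜 := ℝ) (Π i : ℕ, CoarseSpace P i) (Tail P k)).comp
    (Slot.inl (𝕜 := ℝ) (BondSpace P) (PlaqSpace P × (UnitPlaqSpace P k × EuclideanSpace ℝ (Site P 0))))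

variable (P) in
/-- plumbing: the slot of `Ω²_η ⊕ Ω²_1 ⊕ Ω⁰_η` in the canonical carrier. [cite: BalabanImbrieJaffe1988, (2.20) p.262] -/
def slotT (k : ℕ) : Slot (𝕜 := ℝ) (PlaqSpace P × (UnitPlaqSpace P k × EuclideanSpace ℝ (Site P 0))) (Carrier P k) :=
  (Slot.inr (𝕜 := ℝ) (Π i : ℕ, CoarseSpace P i) (Tail P k)).comp
    (Slot.inr (𝕜 := ℝ) (BondSpace P) (PlaqSpace P × (UnitPlaqSpace P k × EuclideanSpace ℝ (Site P 0))))

variable (P) in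
/-- plumbing: the slot of the η-plaquette fields in the canonical carrier. [cite: BalabanImbrieJaffe1988, (2.20) p.262] -/
def slotEta (k : ℕ) : Slot (𝕜 := ℝ) (PlaqSpace P) (Carrier P k) :=
  (slotT P k).comp (Slot.inl (𝕜 := ℝ) (PlaqSpace P) (UnitPlaqSpace P k × EuclideanSpace ℝ (Site P 0)))

variable (P) in
/-- plumbing: the slot of the unit-lattice plaquette fields on `T^{(k)}` in the canonical carrier. [cite: BalabanImbrieJaffe1988, (2.20) p.262] -/
def slotOne (k : ℕ) : Slot (𝕜 := ℝ) (UnitPlaqSpace P k) (Carrier P k) :=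
  ((slotT P k).comp (Slot.inr (𝕜 := ℝ) (PlaqSpace P) (UnitPlaqSpace P k × EuclideanSpace ℝ (Site P 0)))).comp
    (Slot.inl (𝕜 := ℝ) (UnitPlaqSpace P k) (EuclideanSpace ℝ (Site P 0)))

variable (P) in
/-- plumbing: the slot of the gauge functions in the canonical carrier. [cite: BalabanImbrieJaffe1988, (2.20) p.262] -/
def slotG (k : ℕ) : Slot (𝕜 := ℝ) (EuclideanSpace ℝ (Site P 0)) (Carrier P k) :=
  ((slotT P k).comp (Slot.inr (𝕜 := ℝ) (PlaqSpace P) (UnitPlaqSpace P k × EuclideanSpace ℝ (Site P 0)))).comp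
    (Slot.inr (𝕜 := ℝ) (UnitPlaqSpace P k) (EuclideanSpace ℝ (Site P 0)))

/-- On the canonical carrier the unit-plaquette slot does not see the η-bond fields (`π_{Ω²_1} ∘ ι_{Ω¹_η} = 0`).
[cite: BalabanImbrieJaffe1988, (2.20) p.262] -/
theorem slotOne_orth_slotA (k : ℕ) : (slotOne P k).π ∘ₗ (slotA P k).ι = 0 :=
  LinearMap.ext fun _ => rfl

/-- On the canonical carrier the `T^{(k)}`-bond slot does not see the gauge functions (`π_{Ω¹_1} ∘ ι_{Ω⁰_η} = 0`).
[cite: BalabanImbrieJaffe1988, (2.20) p.262] -/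
theorem slotB_orth_slotG (k : ℕ) : (slotB P k k).π ∘ₗ (slotG P k).ι = 0 :=
  LinearMap.ext fun _ => rfl

/-- **Row C2.Eq2.20's typed statement with the typed (2.22) kernel `cK`, inhabited with no choice and no hypothesis left**: on the
canonical carrier `Carrier P k` with the product slots, the two orthogonality side conditions of `eq220_typed_torus` hold
(`slotOne_orth_slotA`, `slotB_orth_slotG`), so `Eq220 … (cK …)` holds outright for the embedded torus operators; `k ≤ m + K`, `c ≠ 0`,
`w > 0`, `2 ≤ d`. [cite: BalabanImbrieJaffe1988, (2.20)–(2.22) p.262] -/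
theorem eq220_typed_torus_prod (hd : 2 ≤ P.d) {k : ℕ} (hk : k ≤ P.m + P.K) {c : ℝ} (hc : c ≠ 0) {w : ℝ} (hw : 0 < w) :
    BIJ88Sect2Statements.Eq220 (emb (slotA P k) (slotB P k k) (QsE P k)) (emb (slotA P k) (slotA P k) (DkE P w c k))
      (emb (slotA P k) (slotEta P k) (LinearMap.adjoint (curlOp (P := P) w c)))
      (emb (slotEta P k) (slotOne P k) (QesOp (P := P) hd w k))
      (emb (slotOne P k) (slotB P k k) (dOne P k c) + emb (slotA P k) (slotG P k) (gradV1 P c))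
      (emb (slotA P k) (slotB P k k) (HkE P w c k))
      (BIJ88Sect2Statements.cK (emb (slotG P k) (slotB P k k) (DjE P w c k)) (fun j => emb (slotG P k) (slotB P k j) (DjE P w c j))
        (fun j => emb (slotB P k j) (slotB P k j) (CE P w c j))
        (fun j => emb (slotB P k j) (slotA P k) (LinearMap.adjoint (HkE P w c j)))
        (emb (slotA P k) (slotEta P k) (LinearMap.adjoint (curlOp (P := P) w c)) *
          emb (slotEta P k) (slotOne P k) (QesOp (P := P) hd w k) *
          (emb (slotOne P k) (slotB P k k) (dOne P k c) + emb (slotA P k) (slotG P k) (gradV1 P c))) k) :=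
  eq220_typed_torus (slotB P k) (slotA P k) (slotEta P k) (slotG P k) (slotOne P k) hd hk hc hw (slotOne_orth_slotA k)
    (slotB_orth_slotG k)

end Canonical

end

end Literature.MathematicalPhysics.QuantumFieldTheory.BalabanImbrieJaffe1984to88.BIJ88Eq220Torus
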